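import Summits.HodgeConjecture.HodgeConjecture.Theorems.NikulinTwinTransportSquareGlueKunneth
import Summits.HodgeConjecture.HodgeConjecture.Theorems.NikulinTwinTransportSquareGlueActions
import Summits.HodgeConjecture.HodgeConjecture.Theorems.NikulinTwinTransportSquareGlueHodge

/-!
# Route NikulinTwinTransport · `SquareGlue` (stmt-HodgeConjecture-13682) — Künneth bookkeeping VII:
# rational `(1,1)`- and `(3,3)`-classes on `S × S` are algebraic

Helper file for the glue item `SquareGlue`: the degree-`2` and degree-`6` parts of
`HodgeConjectureFor 4 (S ⊗ S)` for a K3-type surface `S`, GRANTED the Künneth spanning property for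
`(S ⊗ S)(ℂ)` (degrees `2`, `6`, `8`), `b₁(S) = b₃(S) = 0`, Lefschetz `(1,1)` for `S`, a Hodge model of `S` and the
named facts `hodgePQ_independent_of_hodgeModel`, `exists_deRhamIsoFamily` (bookkeeping IV; the Hodge
model of `S ⊗ S` is supplied by the Hodge-type hypothesis). With a rational generator `p₀` of `H⁴(S)` and the fibre integrals
`pr₁*pr₂^* p₀ = κ • 1`, `pr₂*pr₁^* p₀ = κ' • 1`:

* degree `2`: `c = pr₁^* a + pr₂^* b` with `a = κ⁻¹ pr₁*(pr₂^* p₀ ∪ c)`, `b = κ'⁻¹ pr₂*(pr₁^* p₀ ∪ c)`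
  (uniqueness `eq_zero_of_corr_eq_zero_two`), and `a`, `b` are (up to the orientation scalar)
  rational `(1,1)`-classes, hence divisor classes;
* degree `6`: `c = pr₁^* a ∪ pr₂^* p₀ + pr₁^* p₀ ∪ pr₂^* b` with `a = κ⁻¹ pr₁* c`, `b = κ'⁻¹ pr₂* c`
  (uniqueness `eq_zero_of_corr_eq_zero_six`), `a`, `b` divisor classes, and the exterior products
  of algebraic classes are algebraic.

Prover seat prover-pitem-stmt-HodgeConjecture-13682-0.
-/

noncomputable section

namespace Summit.HodgeConjecture.HodgeConjecture.Theorems.NikulinTwinTransport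

open scoped Manifold
open Module CategoryTheory MonoidalCategory CartesianMonoidalCategory
open Literature.AlgebraicGeometry.Motives Literature.AlgebraicGeometry.HodgeTheory
open Literature.AlgebraicGeometry.Surfaces
open Literature.AlgebraicTopology.SingularHomology

variable {S S' : SchemeOver ℂ}

/-! ### Uniqueness in degrees `2` and `6` -/

/-- **Uniqueness in degree `2`**: for smooth projective surfaces `S`, `S'` with `H³(S'(ℂ)) = 0` and the
Künneth spanning property in degree `6` of `(S ⊗ S')(ℂ)`, a class `c ∈ H²((S ⊗ S')(ℂ))` with
`pr₁*(pr₂^* w ∪ c) = 0` for all `w ∈ H⁴(S')` and `pr₂*(pr₁^* b ∪ c) = 0` for all `b ∈ H⁴(S)` is zero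
(`cupPairing_corrFst_eq`, `cupPairing_corrSnd_eq`, `eq_zero_of_forall_cupPairing_cross_eq_zero`).
[cite: HatcherAT2002, §3.2 Thm. 3.15 and §3.3 Prop. 3.38] -/
theorem eq_zero_of_corr_eq_zero_two (μ : OrientationFamily)
    (hS : IsSmoothProjective 2 S) (hS' : IsSmoothProjective 2 S')
    (hK6 : ∀ z : complexBetti (S ⊗ S') 6, z ∈ Submodule.span ℂ
      {v | ∃ (i j : ℕ) (h : i + j = 6) (b : complexBetti S i) (w : complexBetti S' j),
        v = cupProduct h (complexBetti.map (fst S S') i b) (complexBetti.map (snd S S') j w)})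
    (h3 : Subsingleton (complexBetti S' 3))
    {c : complexBetti (S ⊗ S') (2 * 1)}
    (hB4 : ∀ w : complexBetti S' (2 * 2),
      complexGysin μ (IsSmoothProjective.tensor_holds hS hS') hS (fst S S')
        (rfl : 2 * 2 + 2 * 1 + 2 * 2 = 2 * 1 + 2 * (2 + 2))
        (cupProduct (rfl : 2 * 2 + 2 * 1 = 2 * 2 + 2 * 1) (complexBetti.map (snd S S') (2 * 2) w) c) = 0)
    (hC4 : ∀ b : complexBetti S (2 * 2),
      complexGysin μ (IsSmoothProjective.tensor_holds hS hS') hS' (snd S S')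
        (rfl : 2 * 2 + 2 * 1 + 2 * 2 = 2 * 1 + 2 * (2 + 2))
        (cupProduct (rfl : 2 * 2 + 2 * 1 = 2 * 2 + 2 * 1) (complexBetti.map (fst S S') (2 * 2) b) c) = 0) :
    c = 0 := by
  have hsign : ∀ n : ℕ, ((-1 : ℂ) ^ n) ≠ 0 := fun n => pow_ne_zero _ (neg_ne_zero.2 one_ne_zero)
  refine eq_zero_of_forall_cupPairing_cross_eq_zero μ hS hS' (rfl : 2 * 1 + 6 = 2 * (2 + 2)) hK6
    fun i j hij b w => ?_
  rcases (show j = 2 * 1 ∨ j = 3 ∨ j = 2 * 2 ∨ j < 2 ∨ 4 < j by omega) with rfl | rfl | rfl | hj | hj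
  · obtain rfl : i = 2 * 2 := by omega
    have key := cupPairing_corrSnd_eq μ hS hS' (rfl : 2 * 1 + 6 = 2 * (2 + 2)) hij
      (rfl : 2 * 2 + 2 * 1 = 2 * 2 + 2 * 1) (rfl : 2 * 2 + 2 * 1 + 2 * 2 = 2 * 1 + 2 * (2 + 2))
      (rfl : 2 * 1 + 2 * 1 = 2 * 2) c b w
    rw [hC4 b, map_zero, LinearMap.zero_apply] at key
    exact (mul_eq_zero.1 key.symm).resolve_left (hsign _)
  · rw [Subsingleton.elim w 0, map_zero, map_zero, map_zero]
  · obtain rfl : i = 2 * 1 := by omega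
    have key := cupPairing_corrFst_eq μ hS hS' (rfl : 2 * 1 + 6 = 2 * (2 + 2)) hij
      (rfl : 2 * 2 + 2 * 1 = 2 * 2 + 2 * 1) (rfl : 2 * 2 + 2 * 1 + 2 * 2 = 2 * 1 + 2 * (2 + 2))
      (rfl : 2 * 1 + 2 * 1 = 2 * 2) c b w
    rw [hB4 w, map_zero, LinearMap.zero_apply] at key
    exact (mul_eq_zero.1 key.symm).resolve_left (hsign _)
  · haveI := subsingleton_complexBetti hS (show 2 * 2 < i by omega)
    rw [Subsingleton.elim b 0, map_zero, LinearMap.map_zero₂, map_zero]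
  · haveI := subsingleton_complexBetti hS' (show 2 * 2 < j by omega)
    rw [Subsingleton.elim w 0, map_zero, map_zero, map_zero]

/-- **Uniqueness in degree `6`**: for smooth projective surfaces `S`, `S'` with `H¹(S'(ℂ)) = 0` and the
Künneth spanning property in degree `2` of `(S ⊗ S')(ℂ)`, a class `c ∈ H⁶((S ⊗ S')(ℂ))` with
`pr₁*(pr₂^* w ∪ c) = 0` for all `w ∈ H⁰(S')` and `pr₂*(pr₁^* b ∪ c) = 0` for all `b ∈ H⁰(S)` is zero.
[cite: HatcherAT2002, §3.2 Thm. 3.15 and §3.3 Prop. 3.38] -/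
theorem eq_zero_of_corr_eq_zero_six (μ : OrientationFamily)
    (hS : IsSmoothProjective 2 S) (hS' : IsSmoothProjective 2 S')
    (hK2 : ∀ z : complexBetti (S ⊗ S') 2, z ∈ Submodule.span ℂ
      {v | ∃ (i j : ℕ) (h : i + j = 2) (b : complexBetti S i) (w : complexBetti S' j),
        v = cupProduct h (complexBetti.map (fst S S') i b) (complexBetti.map (snd S S') j w)})
    (h1 : Subsingleton (complexBetti S' 1))
    {c : complexBetti (S ⊗ S') (2 * 3)}
    (hB0 : ∀ w : complexBetti S' 0,
      complexGysin μ (IsSmoothProjective.tensor_holds hS hS') hS (fst S S')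
        (rfl : 2 * 3 + 2 * 2 = 2 * 1 + 2 * (2 + 2))
        (cupProduct (Nat.zero_add (2 * 3)) (complexBetti.map (snd S S') 0 w) c) = 0)
    (hC0 : ∀ b : complexBetti S 0,
      complexGysin μ (IsSmoothProjective.tensor_holds hS hS') hS' (snd S S')
        (rfl : 2 * 3 + 2 * 2 = 2 * 1 + 2 * (2 + 2))
        (cupProduct (Nat.zero_add (2 * 3)) (complexBetti.map (fst S S') 0 b) c) = 0) :
    c = 0 := by
  have hsign : ∀ n : ℕ, ((-1 : ℂ) ^ n) ≠ 0 := fun n => pow_ne_zero _ (neg_ne_zero.2 one_ne_zero)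
  refine eq_zero_of_forall_cupPairing_cross_eq_zero μ hS hS' (rfl : 2 * 3 + 2 = 2 * (2 + 2)) hK2
    fun i j hij b w => ?_
  rcases (show j = 0 ∨ j = 1 ∨ j = 2 * 1 by omega) with rfl | rfl | rfl
  · obtain rfl : i = 2 * 1 := by omega
    have key := cupPairing_corrFst_eq μ hS hS' (rfl : 2 * 3 + 2 = 2 * (2 + 2)) hij
      (Nat.zero_add (2 * 3)) (rfl : 2 * 3 + 2 * 2 = 2 * 1 + 2 * (2 + 2)) (rfl : 2 * 1 + 2 * 1 = 2 * 2) c b w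
    rw [hB0 w, map_zero, LinearMap.zero_apply] at key
    exact (mul_eq_zero.1 key.symm).resolve_left (hsign _)
  · rw [Subsingleton.elim w 0, map_zero, map_zero, map_zero]
  · obtain rfl : i = 0 := by omega
    have key := cupPairing_corrSnd_eq μ hS hS' (rfl : 2 * 3 + 2 = 2 * (2 + 2)) hij
      (Nat.zero_add (2 * 3)) (rfl : 2 * 3 + 2 * 2 = 2 * 1 + 2 * (2 + 2)) (rfl : 2 * 1 + 2 * 1 = 2 * 2) c b w
    rw [hC0 b, map_zero, LinearMap.zero_apply] at key
    exact (mul_eq_zero.1 key.symm).resolve_left (hsign _)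

/-! ### Degree `2`: rational `(1,1)`-classes on `S × S` -/

/-- **Rational `(1,1)`-classes on `S × S` are algebraic** for a smooth projective surface `S` with
`H³(S(ℂ)) = 0`, a rational generator `p₀` of `H⁴(S(ℂ))` and Lefschetz `(1,1)` for `S`, GRANTED the
Künneth spanning property in degrees `6`, `8` and the named facts `hodgePQ_independent_of_hodgeModel`,
`exists_deRhamIsoFamily`: with the fibre integrals `pr₁*pr₂^* p₀ = κ • 1`,
`pr₂*pr₁^* p₀ = κ' • 1`, `c = pr₁^* a + pr₂^* b` for `a = κ⁻¹ pr₁*(pr₂^* p₀ ∪ c)`,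
`b = κ'⁻¹ pr₂*(pr₁^* p₀ ∪ c)` (`eq_zero_of_corr_eq_zero_two`), and `a`, `b` are, up to the orientation
scalar, rational classes of type `(1,1)` (`isOfHodgeType_corrFst/Snd`), hence divisor classes. This is
the Künneth bookkeeping "`Hdg²(S × S) = pr₁^* NS ⊕ pr₂^* NS`" (`b₁ = 0`). [cite: Varesco2023, §2 (p. 8)]
[cite: HatcherAT2002, §3.2 Thm. 3.15] -/
theorem mem_algebraicClasses_one_of_kunneth (hI : hodgePQ_independent_of_hodgeModel)
    (hdR : ∀ (E : Type) [NormedAddCommGroup E] [NormedSpace ℂ E] [FiniteDimensional ℂ E],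
      Literature.NumberTheory.Transcendental.exists_deRhamIsoFamily 𝓘(ℝ, E))
    (μ : OrientationFamily) (hS : IsSmoothProjective 2 S) (A : HodgeModel 2 S)
    (hK6 : ∀ z : complexBetti (S ⊗ S) 6, z ∈ Submodule.span ℂ
      {v | ∃ (i j : ℕ) (h : i + j = 6) (b : complexBetti S i) (w : complexBetti S j),
        v = cupProduct h (complexBetti.map (fst S S) i b) (complexBetti.map (snd S S) j w)})
    (hKtop : ∀ z : complexBetti (S ⊗ S) (2 * (2 + 2)), z ∈ Submodule.span ℂ
      {v | ∃ (i j : ℕ) (h : i + j = 2 * (2 + 2)) (b : complexBetti S i) (w : complexBetti S j),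
        v = cupProduct h (complexBetti.map (fst S S) i b) (complexBetti.map (snd S S) j w)})
    (h3 : Subsingleton (complexBetti S 3))
    {p₀ : complexBetti S (2 * 2)} (hp₀ : p₀ ≠ 0) (hp₀rat : IsRationalClass p₀)
    (hL11 : ∀ c : complexBetti S (2 * 1), IsRationalClass c → IsOfHodgeType 2 S (2 * 1) 1 1 c →
      c ∈ algebraicClasses S 1)
    (c : complexBetti (S ⊗ S) (2 * 1)) (hc : IsRationalClass c)
    (hct : IsOfHodgeType (2 + 2) (S ⊗ S) (2 * 1) 1 1 c) :
    c ∈ algebraicClasses (S ⊗ S) 1 := by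
  obtain ⟨B, -⟩ := id hct
  have hp₀typ : IsOfHodgeType 2 S (2 * 2) 2 2 p₀ := isOfHodgeType_top A p₀
  obtain ⟨κ, hκ0, hκ⟩ := exists_fibreIntegral_fst μ hS hS hKtop hp₀ (rfl : 2 * 2 + 2 * 2 = 0 + 2 * (2 + 2))
  obtain ⟨κ', hκ'0, hκ'⟩ := exists_fibreIntegral_snd μ hS hS hKtop hp₀ (rfl : 2 * 2 + 2 * 2 = 0 + 2 * (2 + 2))
  -- the candidate components
  set Ga : complexBetti S (2 * 1) := complexGysin μ (IsSmoothProjective.tensor_holds hS hS) hS (fst S S)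
      (rfl : 2 * 2 + 2 * 1 + 2 * 2 = 2 * 1 + 2 * (2 + 2))
      (cupProduct (rfl : 2 * 2 + 2 * 1 = 2 * 2 + 2 * 1) (complexBetti.map (snd S S) (2 * 2) p₀) c) with hGa
  set Gb : complexBetti S (2 * 1) := complexGysin μ (IsSmoothProjective.tensor_holds hS hS) hS (snd S S)
      (rfl : 2 * 2 + 2 * 1 + 2 * 2 = 2 * 1 + 2 * (2 + 2))
      (cupProduct (rfl : 2 * 2 + 2 * 1 = 2 * 2 + 2 * 1) (complexBetti.map (fst S S) (2 * 2) p₀) c) with hGb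
  set a : complexBetti S (2 * 1) := κ⁻¹ • Ga with ha
  set b : complexBetti S (2 * 1) := κ'⁻¹ • Gb with hb
  -- `c = pr₁^* a + pr₂^* b`
  have hc0 : c - complexBetti.map (fst S S) (2 * 1) a - complexBetti.map (snd S S) (2 * 1) b = 0 := by
    refine eq_zero_of_corr_eq_zero_two μ hS hS hK6 h3 (fun w => ?_) (fun b₄ => ?_)
    · obtain ⟨t, rfl⟩ := exists_eq_smul_of_top μ hS hp₀ w
      rw [map_smul, LinearMap.map_smul₂, map_smul, map_sub, map_sub, map_sub, map_sub, ← hGa,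
        corrFst_mapFst_of_fibreIntegral μ hS hS (rfl : 2 * 2 + 2 * 1 = 2 * 2 + 2 * 1) _ _ hκ a,
        corrFst_mapSnd_eq_zero_of_lt μ hS hS (rfl : 2 * 2 + 2 * 1 = 2 * 2 + 2 * 1) _ (by norm_num),
        sub_zero, ha, smul_smul, mul_inv_cancel₀ hκ0, one_smul, sub_self, smul_zero]
    · obtain ⟨t, rfl⟩ := exists_eq_smul_of_top μ hS hp₀ b₄
      rw [map_smul, LinearMap.map_smul₂, map_smul, map_sub, map_sub, map_sub, map_sub, ← hGb,
        corrSnd_mapFst_eq_zero_of_lt μ hS hS (rfl : 2 * 2 + 2 * 1 = 2 * 2 + 2 * 1) _ (by norm_num),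
        corrSnd_mapSnd_of_fibreIntegral μ hS hS (rfl : 2 * 2 + 2 * 1 = 2 * 2 + 2 * 1) _ _ hκ' b,
        sub_zero, hb, smul_smul, mul_inv_cancel₀ hκ'0, one_smul, sub_self, smul_zero]
  have hceq : c = complexBetti.map (fst S S) (2 * 1) a + complexBetti.map (snd S S) (2 * 1) b := by
    rw [sub_sub, sub_eq_zero] at hc0
    exact hc0
  -- `a`, `b` are divisor classes
  have haNS : a ∈ algebraicClasses S 1 := by
    obtain ⟨u, hu0, hu⟩ := exists_smul_complexGysin_isRationalClass μ (IsSmoothProjective.tensor_holds hS hS)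
      hS (fst S S) (rfl : 2 * 2 + 2 * 1 + 2 * 2 = 2 * 1 + 2 * (2 + 2))
    have hrat : IsRationalClass (u • Ga) := hu _ (IsRationalClass.cup _ (IsRationalClass.map _ hp₀rat) hc)
    have htyp : IsOfHodgeType 2 S (2 * 1) 1 1 Ga := isOfHodgeType_corrFst hI hdR μ hS hS B A
      (rfl : 2 * 2 + 2 * 1 = 2 * 2 + 2 * 1) _ hct (rfl : 1 + 2 = 2 + 1) (rfl : 1 + 2 = 2 + 1) hp₀typ
    have hmem : u • Ga ∈ algebraicClasses S 1 := hL11 _ hrat (isOfHodgeType_smul' htyp u)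
    have hGamem : Ga ∈ algebraicClasses S 1 := by
      rw [← one_smul ℂ Ga, ← inv_mul_cancel₀ hu0, ← smul_smul]
      exact Submodule.smul_mem _ _ hmem
    exact Submodule.smul_mem _ _ hGamem
  have hbNS : b ∈ algebraicClasses S 1 := by
    obtain ⟨u, hu0, hu⟩ := exists_smul_complexGysin_isRationalClass μ (IsSmoothProjective.tensor_holds hS hS)
      hS (snd S S) (rfl : 2 * 2 + 2 * 1 + 2 * 2 = 2 * 1 + 2 * (2 + 2))
    have hrat : IsRationalClass (u • Gb) := hu _ (IsRationalClass.cup _ (IsRationalClass.map _ hp₀rat) hc)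
    have htyp : IsOfHodgeType 2 S (2 * 1) 1 1 Gb := isOfHodgeType_corrSnd hI hdR μ hS hS B A
      (rfl : 2 * 2 + 2 * 1 = 2 * 2 + 2 * 1) _ hct (rfl : 1 + 2 = 2 + 1) (rfl : 1 + 2 = 2 + 1) hp₀typ
    have hmem : u • Gb ∈ algebraicClasses S 1 := hL11 _ hrat (isOfHodgeType_smul' htyp u)
    have hGbmem : Gb ∈ algebraicClasses S 1 := by
      rw [← one_smul ℂ Gb, ← inv_mul_cancel₀ hu0, ← smul_smul]
      exact Submodule.smul_mem _ _ hmem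
    exact Submodule.smul_mem _ _ hGbmem
  rw [hceq]
  exact Submodule.add_mem _ (map_fst_mem_algebraicClasses hS hS haNS) (map_snd_mem_algebraicClasses hS hS hbNS)

/-! ### Degree `6`: rational `(3,3)`-classes on `S × S` -/

/-- **Rational `(3,3)`-classes on `S × S` are algebraic** for a smooth projective surface `S` with
`H¹(S(ℂ)) = 0`, a generator `p₀` of `H⁴(S(ℂ))` and Lefschetz `(1,1)` for `S`, GRANTED the Künneth
spanning property in degrees `2`, `8` and the named facts `hodgePQ_independent_of_hodgeModel`,
`exists_deRhamIsoFamily`: `c = pr₁^* a ∪ pr₂^* p₀ + pr₁^* p₀ ∪ pr₂^* b` with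
`a = κ⁻¹ pr₁* c`, `b = κ'⁻¹ pr₂* c` (`eq_zero_of_corr_eq_zero_six`, projection formula), `a`, `b` are up
to the orientation scalar rational `(1,1)`-classes (Gysin morphisms shift types by `(-2,-2)`), hence
divisor classes, `p₀` is algebraic (top degree) and exterior products of algebraic classes are
algebraic. ("`Hdg⁶(S × S) = NS ⊗ [pt] ⊕ [pt] ⊗ NS`".) [cite: Varesco2023, §2 (p. 8)]
[cite: VoisinHodgeII2003, proof of Prop. 9.20 (first display)] -/
theorem mem_algebraicClasses_three_of_kunneth (hI : hodgePQ_independent_of_hodgeModel)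
    (hdR : ∀ (E : Type) [NormedAddCommGroup E] [NormedSpace ℂ E] [FiniteDimensional ℂ E],
      Literature.NumberTheory.Transcendental.exists_deRhamIsoFamily 𝓘(ℝ, E))
    (μ : OrientationFamily) (hS : IsSmoothProjective 2 S) (A : HodgeModel 2 S)
    (hK2 : ∀ z : complexBetti (S ⊗ S) 2, z ∈ Submodule.span ℂ
      {v | ∃ (i j : ℕ) (h : i + j = 2) (b : complexBetti S i) (w : complexBetti S j),
        v = cupProduct h (complexBetti.map (fst S S) i b) (complexBetti.map (snd S S) j w)})
    (hKtop : ∀ z : complexBetti (S ⊗ S) (2 * (2 + 2)), z ∈ Submodule.span ℂ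
      {v | ∃ (i j : ℕ) (h : i + j = 2 * (2 + 2)) (b : complexBetti S i) (w : complexBetti S j),
        v = cupProduct h (complexBetti.map (fst S S) i b) (complexBetti.map (snd S S) j w)})
    (h1 : Subsingleton (complexBetti S 1))
    {p₀ : complexBetti S (2 * 2)} (hp₀ : p₀ ≠ 0)
    (hL11 : ∀ c : complexBetti S (2 * 1), IsRationalClass c → IsOfHodgeType 2 S (2 * 1) 1 1 c →
      c ∈ algebraicClasses S 1)
    (c : complexBetti (S ⊗ S) (2 * 3)) (hc : IsRationalClass c)
    (hct : IsOfHodgeType (2 + 2) (S ⊗ S) (2 * 3) 3 3 c) :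
    c ∈ algebraicClasses (S ⊗ S) 3 := by
  have hμ := μ.hasPoincareDuality
  obtain ⟨B, -⟩ := id hct
  obtain ⟨κ, hκ0, hκ⟩ := exists_fibreIntegral_fst μ hS hS hKtop hp₀ (rfl : 2 * 2 + 2 * 2 = 0 + 2 * (2 + 2))
  obtain ⟨κ', hκ'0, hκ'⟩ := exists_fibreIntegral_snd μ hS hS hKtop hp₀ (rfl : 2 * 2 + 2 * 2 = 0 + 2 * (2 + 2))
  set Ga : complexBetti S (2 * 1) := complexGysin μ (IsSmoothProjective.tensor_holds hS hS) hS (fst S S)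
      (rfl : 2 * 3 + 2 * 2 = 2 * 1 + 2 * (2 + 2)) c with hGa
  set Gb : complexBetti S (2 * 1) := complexGysin μ (IsSmoothProjective.tensor_holds hS hS) hS (snd S S)
      (rfl : 2 * 3 + 2 * 2 = 2 * 1 + 2 * (2 + 2)) c with hGb
  set a : complexBetti S (2 * 1) := κ⁻¹ • Ga with ha
  set b : complexBetti S (2 * 1) := κ'⁻¹ • Gb with hb
  set X₁ : complexBetti (S ⊗ S) (2 * 3) := cupProduct (rfl : 2 * 1 + 2 * 2 = 2 * 3)
      (complexBetti.map (fst S S) (2 * 1) a) (complexBetti.map (snd S S) (2 * 2) p₀) with hX₁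
  set X₂ : complexBetti (S ⊗ S) (2 * 3) := cupProduct (rfl : 2 * 2 + 2 * 1 = 2 * 3)
      (complexBetti.map (fst S S) (2 * 2) p₀) (complexBetti.map (snd S S) (2 * 1) b) with hX₂
  have hone_snd : complexBetti.map (snd S S) 0 (singularCohomology.one ℂ (ComplexPoints S)) =
      singularCohomology.one ℂ (ComplexPoints (S ⊗ S)) := singularCohomology.map_one _
  have hone_fst : complexBetti.map (fst S S) 0 (singularCohomology.one ℂ (ComplexPoints S)) =
      singularCohomology.one ℂ (ComplexPoints (S ⊗ S)) := singularCohomology.map_one _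
  -- `pr₁* X₁ = κ a`, `pr₁* X₂ = 0`, `pr₂* X₁ = 0`, `pr₂* X₂ = κ' b`
  have hfX₁ : complexGysin μ (IsSmoothProjective.tensor_holds hS hS) hS (fst S S)
      (rfl : 2 * 3 + 2 * 2 = 2 * 1 + 2 * (2 + 2)) X₁ = κ • a := by
    rw [hX₁, complexGysin_cup hμ (IsSmoothProjective.tensor_holds hS hS) hS (fst S S)
      (rfl : 2 * 1 + 2 * 2 = 2 * 3) _ (rfl : 2 * 2 + 2 * 2 = 0 + 2 * (2 + 2)) (Nat.add_zero (2 * 1)) a _,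
      hκ, map_smul, cupProduct_one]
  have hfX₂ : complexGysin μ (IsSmoothProjective.tensor_holds hS hS) hS (fst S S)
      (rfl : 2 * 3 + 2 * 2 = 2 * 1 + 2 * (2 + 2)) X₂ = 0 := by
    rw [hX₂]
    exact complexGysin_cup_map_eq_zero_of_lt (IsSmoothProjective.tensor_holds hS hS) hS (fst S S)
      (rfl : 2 * 2 + 2 * 1 = 2 * 3) _ (by norm_num) p₀ _
  have hsX₁ : complexGysin μ (IsSmoothProjective.tensor_holds hS hS) hS (snd S S)
      (rfl : 2 * 3 + 2 * 2 = 2 * 1 + 2 * (2 + 2)) X₁ = 0 := by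
    rw [hX₁]
    exact corrSnd_mapSnd_eq_zero_of_lt μ hS hS (rfl : 2 * 1 + 2 * 2 = 2 * 3) _ (by norm_num) a p₀
  have hsX₂ : complexGysin μ (IsSmoothProjective.tensor_holds hS hS) hS (snd S S)
      (rfl : 2 * 3 + 2 * 2 = 2 * 1 + 2 * (2 + 2)) X₂ = κ' • b := by
    rw [hX₂]
    exact corrSnd_mapSnd_of_fibreIntegral μ hS hS (rfl : 2 * 2 + 2 * 1 = 2 * 3) _ _ hκ' b
  -- `c = X₁ + X₂`
  have hc0 : c - X₁ - X₂ = 0 := by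
    refine eq_zero_of_corr_eq_zero_six μ hS hS hK2 h1 (fun w => ?_) (fun b₀ => ?_)
    · obtain ⟨t, rfl⟩ := exists_eq_smul_one μ hS w
      rw [map_smul, LinearMap.map_smul₂, map_smul, hone_snd, one_cupProduct, map_sub, map_sub, ← hGa, hfX₁,
        hfX₂, sub_zero, ha, smul_smul, mul_inv_cancel₀ hκ0, one_smul, sub_self, smul_zero]
    · obtain ⟨t, rfl⟩ := exists_eq_smul_one μ hS b₀
      rw [map_smul, LinearMap.map_smul₂, map_smul, hone_fst, one_cupProduct, map_sub, map_sub, ← hGb, hsX₁,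
        hsX₂, sub_zero, hb, smul_smul, mul_inv_cancel₀ hκ'0, one_smul, sub_self, smul_zero]
  have hceq : c = X₁ + X₂ := by
    rw [sub_sub, sub_eq_zero] at hc0
    exact hc0
  -- `a`, `b` are divisor classes, `p₀` is algebraic
  have haNS : a ∈ algebraicClasses S 1 := by
    obtain ⟨u, hu0, hu⟩ := exists_smul_complexGysin_isRationalClass μ (IsSmoothProjective.tensor_holds hS hS)
      hS (fst S S) (rfl : 2 * 3 + 2 * 2 = 2 * 1 + 2 * (2 + 2))
    have hrat : IsRationalClass (u • Ga) := hu _ hc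
    have htyp : IsOfHodgeType 2 S (2 * 1) 1 1 Ga := isOfHodgeType_complexGysin_of_models hI hdR μ
      (IsSmoothProjective.tensor_holds hS hS) hS B A (fst S S) _ (rfl : 1 + (2 + 2) = 3 + 2)
      (rfl : 1 + (2 + 2) = 3 + 2) hct
    have hmem : u • Ga ∈ algebraicClasses S 1 := hL11 _ hrat (isOfHodgeType_smul' htyp u)
    have hGamem : Ga ∈ algebraicClasses S 1 := by
      rw [← one_smul ℂ Ga, ← inv_mul_cancel₀ hu0, ← smul_smul]
      exact Submodule.smul_mem _ _ hmem
    exact Submodule.smul_mem _ _ hGamem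
  have hbNS : b ∈ algebraicClasses S 1 := by
    obtain ⟨u, hu0, hu⟩ := exists_smul_complexGysin_isRationalClass μ (IsSmoothProjective.tensor_holds hS hS)
      hS (snd S S) (rfl : 2 * 3 + 2 * 2 = 2 * 1 + 2 * (2 + 2))
    have hrat : IsRationalClass (u • Gb) := hu _ hc
    have htyp : IsOfHodgeType 2 S (2 * 1) 1 1 Gb := isOfHodgeType_complexGysin_of_models hI hdR μ
      (IsSmoothProjective.tensor_holds hS hS) hS B A (snd S S) _ (rfl : 1 + (2 + 2) = 3 + 2)
      (rfl : 1 + (2 + 2) = 3 + 2) hct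
    have hmem : u • Gb ∈ algebraicClasses S 1 := hL11 _ hrat (isOfHodgeType_smul' htyp u)
    have hGbmem : Gb ∈ algebraicClasses S 1 := by
      rw [← one_smul ℂ Gb, ← inv_mul_cancel₀ hu0, ← smul_smul]
      exact Submodule.smul_mem _ _ hmem
    exact Submodule.smul_mem _ _ hGbmem
  have hp₀alg : p₀ ∈ algebraicClasses S 2 := mem_algebraicClasses_of_degree_top hS (by norm_num) p₀
  have hX₁alg : X₁ ∈ supportedClasses (S ⊗ S) (2 * 3) (1 + 2) :=
    cupProduct_map_fst_map_snd_mem_supportedClasses hS hS (rfl : 2 * 1 + 2 * 2 = 2 * 3) (r := 1) (s := 2)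
      haNS hp₀alg
  have hX₂alg : X₂ ∈ supportedClasses (S ⊗ S) (2 * 3) (2 + 1) :=
    cupProduct_map_fst_map_snd_mem_supportedClasses hS hS (rfl : 2 * 2 + 2 * 1 = 2 * 3) (r := 2) (s := 1)
      hp₀alg hbNS
  rw [hceq]
  exact Submodule.add_mem _ hX₁alg hX₂alg

end Summit.HodgeConjecture.HodgeConjecture.Theorems.NikulinTwinTransport

end
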